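import Summits.CriticalPhenomena.CardyFormulaZ2.Theses.CardySusyWard
import Literature.Probability.LatticeModels.MedialExplorationChains
import Literature.Probability.LatticeModels.ParafermionBulkNondegenerate

/-!
# `ParafermionPrecompact` (route `CardySusyWard`, stmt-CriticalPhenomena-11293) is FALSE modulo
# bulk non-degeneracy of the `q = 1` parafermion; as typed it collapses to the degenerate
# normalisation; the repaired statement

Refuter `refuter-cdisprove-stmt-CriticalPhenomena-11293-0` (cdisprove unit).  All kernel-checked:

* §1–§3 **Collapse** `parafermionPrecompact_iff_vanishing`: as typed (clauses quantified over all
  `z z' : MedialVertex = Sym2 (Site 2)`), the crux is EQUIVALENT to "`δ^{-1/3} F_δ → 0` uniformly on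
  compacts, for every Dobrushin domain and every admissible family" — the
  opposite of the non-trivial limit `(2δ)^{-1/3} F_δ → (φ′)^{1/3}` of Duminil-Copin–Smirnov 2012,
  Conjecture 8.7 at `q = 1`, whose tightness the crux intends.  Witness: the stretched twin
  `{2x-y, 2y-x}` of `{x, y}` has the same medial point, is never a lattice edge, hence never on the
  exploration path (`mem_edgeSet_of_mem_medialExploration`, unconditional), so `F_δ(twin) = 0` and
  clause (ii) forces `‖F_δ(z)‖ ≤ ε δ^{1/3}` for every `ε`.  (Concurs with the five earlier refuter
  certificates attached to the item, re-derived because gate evidence is not mounted on this hub.)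
* §4 **Negative lemma modulo `H`**: `parafermionPrecompact_false_of_bulkNondegenerate :
  ParafermionBulkNondegenerate → ¬ ParafermionPrecompact`, `H` = ONE admissible discretisation family
  of ONE Dobrushin domain with `limsup_{δ→0⁺} δ^{-1/3} sup_K ‖F_δ‖ > 0` on some compact `K ⊆ Ω` —
  the weakest consequence of DCS 2012 Conj. 8.7 (`(φ′)^{1/3}` vanishes nowhere), an OPEN lower
  bound for bond percolation on `ℤ²` (the only printed a-priori bound is from above,
  `‖F_δ‖ ≤ 2 P(z ∈ γ)`), not constructible in the tree.  Sharper: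
  `parafermionPrecompact_iff_not_bulkNondegenerate` — the typed crux IS `¬H`; under the route's own
  working hypothesis it is false (`refuted-misstated` in substance).
* §5 the minimal repaired statement `ParafermionPrecompactRepairedAt` (edge guards
  `z, z' ∈ (zdGraph 2).edgeSet`; a weakening of the typed crux, `repaired_of_parafermionPrecompact`)
  and `medialPoint_injOn_edgeSet` (guarded medial points are injective: the witness misses C′; C′ is
  DCS tightness at `σ = 1/3`, open/XL, no cheap attack found — see the crux work file
  `Cruxes/ParafermionPrecompact/Disproof.lean` §7).

A companion file `WeakSumControl.lean` (as typed X2 ⇒ X1; boundedness of the weak-holomorphy sums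
under the repaired clause (i)) builds on this one.
-/

noncomputable section

namespace Summit.CriticalPhenomena.CardyFormulaZ2.Theorems.ParafermionPrecompact.Negative

open _root_.Literature.Probability.LatticeModels _root_.Literature.Probability.RandomPlanarGeometry
open _root_.Literature.Probability.Percolation _root_.MeasureTheory _root_.Filter _root_.Set
open scoped _root_.Topology

/-! ## §0 Vocabulary: the observable and the family hypotheses of the crux -/

/-- The `q = 1`, spin-`1/3` parafermionic vertex observable of the exploration interface of the
discrete Dobrushin domain `Λ δ` at the medial vertex `z`, exactly as it appears in the crux:
`F_δ(z) = ∫ passageSum (medialExploration (Λ δ) ω) δ (1/3) z dP_{1/2}`. [folklore] -/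
def F (Λ : ℝ → DiscreteDobrushin) (δ : ℝ) (z : MedialVertex) : ℂ :=
  ∫ ω, passageSum (medialExploration (Λ δ) ω) δ (1 / 3) z ∂(bondPercolation (zdGraph 2) half)

/-- The six (unbundled `ZdDiscretisationFamily`) hypotheses of the crux on a discretisation family
`Λ` of the Dobrushin domain `D`. [folklore] -/
def IsFamily (D : DobrushinDomain) (Λ : ℝ → DiscreteDobrushin) : Prop :=
  (∀ δ, (Λ δ).Ω = D.carrier) ∧ (∀ δ, (Λ δ).δ = δ) ∧
  Tendsto (fun δ : ℝ => Metric.hausdorffEDist (Λ δ).arcA (D.arc 0)) (𝓝[>] 0) (𝓝 0) ∧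
  Tendsto (fun δ : ℝ => Metric.hausdorffEDist (Λ δ).arcB (D.arc 1)) (𝓝[>] 0) (𝓝 0) ∧
  Tendsto (fun δ : ℝ => Metric.hausdorffEDist (medialPoint δ '' (Λ δ).zdABEdges) {D.pt 0, D.pt 1})
    (𝓝[>] 0) (𝓝 0) ∧
  (∀ᶠ δ in 𝓝[>] 0, (Λ δ).IsZdAdmissible)

/-- Clause (i) of the crux for `(D, Λ, K)`: `δ^{-1/3} F_δ` eventually uniformly bounded on `K`. [folklore] -/
def ClauseBound (Λ : ℝ → DiscreteDobrushin) (K : Set ℂ) : Prop :=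
  ∃ C : ℝ, ∀ᶠ δ in 𝓝[>] 0, ∀ z : MedialVertex, medialPoint δ z ∈ K → ‖F Λ δ z‖ ≤ C * δ ^ ((1:ℝ) / 3)

/-- Clause (ii) of the crux for `(D, Λ, K)`: asymptotic equicontinuity of `δ^{-1/3} F_δ` on `K`,
quantified — as typed — over ALL `z z' : MedialVertex = Sym2 (Site 2)`. [folklore] -/
def ClauseEquicont (Λ : ℝ → DiscreteDobrushin) (K : Set ℂ) : Prop :=
  ∀ ε > (0:ℝ), ∃ η > (0:ℝ), ∀ᶠ δ in 𝓝[>] 0, ∀ z z' : MedialVertex,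
    medialPoint δ z ∈ K → medialPoint δ z' ∈ K → dist (medialPoint δ z) (medialPoint δ z') < η →
      ‖F Λ δ z - F Λ δ z'‖ ≤ ε * δ ^ ((1:ℝ) / 3)

/-- Read-back of the crux: `ParafermionPrecompact` is, definitionally, "for every Dobrushin domain,
every family satisfying the six hypotheses and every compact `K ⊆ Ω`: (i) ∧ (ii)". [folklore] -/
theorem parafermionPrecompact_iff :
    Theses.CardySusyWard.ParafermionPrecompact ↔
      ∀ (D : DobrushinDomain) (Λ : ℝ → DiscreteDobrushin), IsFamily D Λ →
        ∀ K : Set ℂ, IsCompact K → K ⊆ D.carrier → ClauseBound Λ K ∧ ClauseEquicont Λ K := by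
  constructor
  · intro h D Λ hΛ K hK hKD
    exact h D Λ hΛ.1 hΛ.2.1 hΛ.2.2.1 hΛ.2.2.2.1 hΛ.2.2.2.2.1 hΛ.2.2.2.2.2 K hK hKD
  · intro h D Λ h1 h2 h3 h4 h5 h6 K hK hKD
    exact h D Λ ⟨h1, h2, h3, h4, h5, h6⟩ K hK hKD

/-! ## §1 Junk medial vertices: the stretched twin of a pair of sites -/

/-- The *stretched twin* of the pair `{x, y}`: the pair `{2x - y, 2y - x}`, which has the same
midpoint and is never a nearest-neighbour edge of `ℤ²`. [folklore] -/
def twin : MedialVertex → MedialVertex :=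
  Sym2.lift ⟨fun x y => s(fun i => 2 * x i - y i, fun i => 2 * y i - x i), fun _ _ => Sym2.eq_swap⟩

/-- Unfolding `twin` on an explicit pair. [folklore] -/
@[simp] theorem twin_mk (x y : Site 2) :
    twin s(x, y) = s(fun i => 2 * x i - y i, fun i => 2 * y i - x i) := rfl

/-- The twin has the same medial point (midpoint). [folklore] -/
theorem medialPoint_twin (δ : ℝ) (z : MedialVertex) : medialPoint δ (twin z) = medialPoint δ z := by
  induction z using Sym2.ind with
  | h x y =>
    rw [twin_mk, medialPoint_mk, medialPoint_mk]
    congr 1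
    apply Complex.ext
    · simp only [Complex.add_re, meshPoint_re]
      push_cast
      ring
    · simp only [Complex.add_im, meshPoint_im]
      push_cast
      ring

/-- The twin is never an edge of `ℤ²` (its endpoints differ by `3 (y - x)`). [folklore] -/
theorem twin_not_mem_edgeSet (z : MedialVertex) : twin z ∉ (zdGraph 2).edgeSet := by
  induction z using Sym2.ind with
  | h x y =>
    rw [twin_mk, SimpleGraph.mem_edgeSet, zdGraph_adj_iff]
    rintro ⟨i, h | h⟩
    · have := congrFun h i
      simp only [Pi.add_apply, Pi.single_eq_same] at this
      omega
    · have := congrFun h i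
      simp only [Pi.add_apply, Pi.single_eq_same] at this
      omega

/-! ## §2 Entries of the exploration path are lattice edges; junk pairs carry `F_δ ≡ 0` -/

/-- A list with distinct head and last element has length at least two. [folklore] -/
theorem two_le_length_of_head_ne_getLast {α : Type*} {l : List α} (h : l ≠ [])
    (h' : l.head h ≠ l.getLast h) : 2 ≤ l.length := by
  match l, h, h' with
  | [a], _, h' => simp at h'
  | a :: b :: l, _, _ => simp

/-- Every entry of the medial exploration path (junk branch `[]` included) is a nearest-neighbour
edge of `ℤ²`: entries are sources/targets of corners `(v, f)`, i.e. `cornerEdge v f i`.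
Unconditional (no admissibility needed). [folklore] -/
theorem mem_edgeSet_of_mem_medialExploration {Dd : DiscreteDobrushin} {ω : BondConfig (Site 2)}
    {e : MedialVertex} (he : e ∈ medialExploration Dd ω) : e ∈ (zdGraph 2).edgeSet := by
  rcases medialExploration_eq_nil_or Dd ω with h | h
  · rw [h] at he
    simp at he
  · have hlen : 2 ≤ (medialExploration Dd ω).length :=
      two_le_length_of_head_ne_getLast h.ne_nil h.head_ne_getLast
    obtain ⟨p, hp, hep⟩ := exists_mem_zip_of_mem _ hlen he
    obtain ⟨v, f, hvf, -, hs, ht⟩ := h.step p.1 p.2 (infix_of_mem_zip_tail _ hp)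
    obtain ⟨a, b, -, hsa, htb⟩ := exists_cornerSource_eq_cornerTarget_eq v f
    rcases hep with rfl | rfl
    · rw [← hs, hsa]
      exact (SimpleGraph.mem_edgeSet _).2 (adj_cornerNeighbor hvf a)
    · rw [← ht, htb]
      exact (SimpleGraph.mem_edgeSet _).2 (adj_cornerNeighbor hvf b)

/-- Off the lattice edges the passage sum of the exploration path vanishes identically. [folklore] -/
theorem passageSum_medialExploration_eq_zero {Dd : DiscreteDobrushin} {ω : BondConfig (Site 2)}
    (δ σ : ℝ) {z : MedialVertex} (hz : z ∉ (zdGraph 2).edgeSet) :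
    passageSum (medialExploration Dd ω) δ σ z = 0 :=
  MedialPath.passageSum_eq_zero_of_not_mem δ σ fun h => hz (mem_edgeSet_of_mem_medialExploration h)

/-- Off the lattice edges the observable vanishes identically, for every family and mesh. [folklore] -/
theorem F_eq_zero_of_not_mem_edgeSet (Λ : ℝ → DiscreteDobrushin) (δ : ℝ) {z : MedialVertex}
    (hz : z ∉ (zdGraph 2).edgeSet) : F Λ δ z = 0 := by
  simp [F, passageSum_medialExploration_eq_zero _ _ hz]

/-- In particular the observable vanishes at every stretched twin. [folklore] -/
theorem F_twin (Λ : ℝ → DiscreteDobrushin) (δ : ℝ) (z : MedialVertex) : F Λ δ (twin z) = 0 :=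
  F_eq_zero_of_not_mem_edgeSet Λ δ (twin_not_mem_edgeSet z)

/-! ## §3 The collapse: as typed, the crux says `δ^{-1/3} F_δ → 0` uniformly on compacts -/

/-- `δ^{-1/3} F_δ → 0` uniformly on `K` (eventual form). [folklore] -/
def VanishesOn (Λ : ℝ → DiscreteDobrushin) (K : Set ℂ) : Prop :=
  ∀ ε > (0:ℝ), ∀ᶠ δ in 𝓝[>] 0, ∀ z : MedialVertex, medialPoint δ z ∈ K → ‖F Λ δ z‖ ≤ ε * δ ^ ((1:ℝ) / 3)

/-- Clause (ii) AS TYPED already forces vanishing: pair `z` with its stretched twin (same medial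
point, distance `0 < η`, observable `0`). [folklore] -/
theorem vanishesOn_of_clauseEquicont {Λ : ℝ → DiscreteDobrushin} {K : Set ℂ}
    (h : ClauseEquicont Λ K) : VanishesOn Λ K := by
  intro ε hε
  obtain ⟨η, hη, hev⟩ := h ε hε
  filter_upwards [hev] with δ hδ z hz
  have := hδ z (twin z) hz (by rwa [medialPoint_twin]) (by rwa [medialPoint_twin, dist_self])
  rwa [F_twin, sub_zero] at this

/-- Conversely vanishing gives both clauses (bound with `C = 1`; equicontinuity by the triangle
inequality with any `η`). [folklore] -/
theorem clauses_of_vanishesOn {Λ : ℝ → DiscreteDobrushin} {K : Set ℂ} (h : VanishesOn Λ K) :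
    ClauseBound Λ K ∧ ClauseEquicont Λ K := by
  refine ⟨⟨1, ?_⟩, fun ε hε => ⟨1, one_pos, ?_⟩⟩
  · filter_upwards [h 1 one_pos] with δ hδ z hz
    exact hδ z hz
  · filter_upwards [h (ε / 2) (half_pos hε)] with δ hδ z z' hz hz' _
    calc ‖F Λ δ z - F Λ δ z'‖ ≤ ‖F Λ δ z‖ + ‖F Λ δ z'‖ := norm_sub_le _ _
      _ ≤ ε / 2 * δ ^ ((1:ℝ) / 3) + ε / 2 * δ ^ ((1:ℝ) / 3) := add_le_add (hδ z hz) (hδ z' hz')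
      _ = ε * δ ^ ((1:ℝ) / 3) := by ring

/-- **Collapse.** AS TYPED, `ParafermionPrecompact` is equivalent to the degenerate normalisation
statement "`δ^{-1/3} F_δ → 0` uniformly on compacts, for every domain and every admissible family" — the opposite of the non-trivial limit `(2δ)^{-1/3} F_δ → (φ′)^{1/3}` of
Duminil-Copin–Smirnov 2012, Conjecture 8.7 at `q = 1`, whose tightness the crux intends to state.
(Concurs with the five earlier refuter certificates on the item.) [folklore] -/
theorem parafermionPrecompact_iff_vanishing :
    Theses.CardySusyWard.ParafermionPrecompact ↔
      ∀ (D : DobrushinDomain) (Λ : ℝ → DiscreteDobrushin), IsFamily D Λ →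
        ∀ K : Set ℂ, IsCompact K → K ⊆ D.carrier → VanishesOn Λ K := by
  rw [parafermionPrecompact_iff]
  refine ⟨fun h D Λ hΛ K hK hKD => vanishesOn_of_clauseEquicont (h D Λ hΛ K hK hKD).2,
    fun h D Λ hΛ K hK hKD => clauses_of_vanishesOn (h D Λ hΛ K hK hKD)⟩


/-! ## §4 Negative lemma modulo bulk non-degeneracy (`H → ¬ crux`) -/

/-! `H` is the Literature fact `Literature.Probability.LatticeModels.ParafermionBulkNondegenerate`
(relocated there by the gate from the first submission of this file, p73986): ONE admissible
family of ONE Dobrushin domain with `limsup_{δ→0⁺} δ^{-1/3} sup_K ‖F_δ‖ > 0` on a compact `K ⊆ Ω` —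
the weakest consequence of DCS 2012 Conjecture 8.7 at `q = 1`, an OPEN lower bound. -/

/-- Non-degeneracy is exactly the failure of the degenerate normalisation statement. [folklore] -/
theorem parafermionBulkNondegenerate_iff_not_vanishing :
    ParafermionBulkNondegenerate ↔
      ¬ ∀ (D : DobrushinDomain) (Λ : ℝ → DiscreteDobrushin), IsFamily D Λ →
        ∀ K : Set ℂ, IsCompact K → K ⊆ D.carrier → VanishesOn Λ K := by
  constructor
  · rintro ⟨D, Λ, hΛ, K, hK, hKD, ε, hε, hfr⟩ hV
    refine hfr ?_
    filter_upwards [hV D Λ hΛ K hK hKD ε hε] with δ hδ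
    rintro ⟨z, hz, hlt⟩
    exact (not_le.2 hlt) (hδ z hz)
  · intro h
    by_contra hN
    refine h fun D Λ hΛ K hK hKD ε hε => ?_
    by_contra hev
    refine hN ⟨D, Λ, hΛ, K, hK, hKD, ε, hε, ?_⟩
    refine (Filter.not_eventually.1 hev).mono fun δ hδ => ?_
    simp only [not_forall, not_le, exists_prop] at hδ
    exact hδ

/-- **Negative lemma modulo `H`.**  Bulk non-degeneracy of the `q = 1` parafermion for ONE
admissible family (a consequence of DCS 2012 Conjecture 8.7 — the conjecture this very route sets
out to prove) REFUTES the crux as typed.  Hence `ParafermionPrecompact` (rev 5) is, under the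
route's own working hypothesis, FALSE; it is `refuted-misstated` in substance (repair: the edge
guards of §5), but no unconditional `¬` is landable because `H` is an open lower bound.
[folklore] -/
theorem parafermionPrecompact_false_of_bulkNondegenerate :
    ParafermionBulkNondegenerate → ¬ Theses.CardySusyWard.ParafermionPrecompact := fun hH hP =>
  (parafermionBulkNondegenerate_iff_not_vanishing.1 hH) (parafermionPrecompact_iff_vanishing.1 hP)

/-- Conversely the crux as typed is PRECISELY the negation of `H`: proving the rev-5 text amounts to
proving that the DCS normalisation is degenerate for every domain and every admissible family.
[folklore] -/
theorem parafermionPrecompact_iff_not_bulkNondegenerate :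
    Theses.CardySusyWard.ParafermionPrecompact ↔ ¬ ParafermionBulkNondegenerate := by
  rw [parafermionPrecompact_iff_vanishing, parafermionBulkNondegenerate_iff_not_vanishing, not_not]

/-! ## §5 The repaired statement `C′` (edge guards) and why the twin witness misses it -/

/-- Clause (i) restricted to genuine medial vertices (nearest-neighbour edges of `ℤ²`). [folklore] -/
def ClauseBoundEdges (Λ : ℝ → DiscreteDobrushin) (K : Set ℂ) : Prop :=
  ∃ C : ℝ, ∀ᶠ δ in 𝓝[>] 0, ∀ z : MedialVertex, z ∈ (zdGraph 2).edgeSet →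
    medialPoint δ z ∈ K → ‖F Λ δ z‖ ≤ C * δ ^ ((1:ℝ) / 3)

/-- Clause (ii) restricted to genuine medial vertices. [folklore] -/
def ClauseEquicontEdges (Λ : ℝ → DiscreteDobrushin) (K : Set ℂ) : Prop :=
  ∀ ε > (0:ℝ), ∃ η > (0:ℝ), ∀ᶠ δ in 𝓝[>] 0, ∀ z z' : MedialVertex,
    z ∈ (zdGraph 2).edgeSet → z' ∈ (zdGraph 2).edgeSet →
    medialPoint δ z ∈ K → medialPoint δ z' ∈ K → dist (medialPoint δ z) (medialPoint δ z') < η →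
      ‖F Λ δ z - F Λ δ z'‖ ≤ ε * δ ^ ((1:ℝ) / 3)

/-- **`C′` — the minimal repaired crux, per domain and family** (concurring with the earlier refuter
repairs on the item): the rev-5 text verbatim with the guard `z ∈ (zdGraph 2).edgeSet →` inserted in
(i) and the two guards `z ∈ (zdGraph 2).edgeSet → z' ∈ (zdGraph 2).edgeSet →` in (ii); the repaired
crux is `∀ D Λ, ParafermionPrecompactRepairedAt D Λ`.  Content: tightness in `C(K)` of
`δ^{-1/3} F_δ` on the medial lattice — the `(2δ)^{-σ}` normalisation of DCS 2012 Conjecture 8.7 at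
`σ = 1/3` (trivial a-priori bound `2 P(z ∈ γ) ≍ δ^{1/4}` by the polychromatic two-arm exponent; the
missing `δ^{1/12}` is winding-phase cancellation).  Believed TRUE, open (XL). [folklore] -/
def ParafermionPrecompactRepairedAt (D : DobrushinDomain) (Λ : ℝ → DiscreteDobrushin) : Prop :=
  IsFamily D Λ → ∀ K : Set ℂ, IsCompact K → K ⊆ D.carrier →
    ClauseBoundEdges Λ K ∧ ClauseEquicontEdges Λ K

/-- `C′` is a weakening of the typed crux (so the planner's restatement loses nothing provable).
[folklore] -/
theorem repaired_of_parafermionPrecompact (h : Theses.CardySusyWard.ParafermionPrecompact)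
    (D : DobrushinDomain) (Λ : ℝ → DiscreteDobrushin) : ParafermionPrecompactRepairedAt D Λ := by
  rw [parafermionPrecompact_iff] at h
  intro hΛ K hK hKD
  obtain ⟨⟨C, hC⟩, hE⟩ := h D Λ hΛ K hK hKD
  refine ⟨⟨C, ?_⟩, fun ε hε => ?_⟩
  · filter_upwards [hC] with δ hδ z _ hz using hδ z hz
  · obtain ⟨η, hη, hev⟩ := hE ε hε
    exact ⟨η, hη, by filter_upwards [hev] with δ hδ z z' _ _ hz hz' hd using hδ z z' hz hz' hd⟩

/-- Coordinate sums are determined by the medial point (`δ ≠ 0`). [folklore] -/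
theorem sum_eq_of_medialPoint_eq {δ : ℝ} (hδ : δ ≠ 0) {a b a' b' : Site 2}
    (h : medialPoint δ s(a, b) = medialPoint δ s(a', b')) (j : Fin 2) : a j + b j = a' j + b' j := by
  have key : δ * (((a j : ℤ) : ℝ) + b j - a' j - b' j) = 0 := by
    fin_cases j
    · have := congrArg Complex.re h
      simp [medialPoint_mk, meshPoint_re] at this
      simp only [Fin.zero_eta, Fin.isValue]
      linarith
    · have := congrArg Complex.im h
      simp [medialPoint_mk, meshPoint_im] at this
      simp only [Fin.mk_one, Fin.isValue]
      linarith
  have h2 := (mul_eq_zero.1 key).resolve_left hδ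
  exact_mod_cast (by linarith : ((a j : ℤ) : ℝ) + b j = a' j + b' j)

/-- Every nearest-neighbour edge of `ℤ²` is `{x, x + e_i}` for some site `x` and direction `i`.
[folklore] -/
theorem exists_eq_mk_add_single {z : MedialVertex} (hz : z ∈ (zdGraph 2).edgeSet) :
    ∃ (x : Site 2) (i : Fin 2), z = s(x, x + Pi.single i 1) := by
  induction z using Sym2.ind with
  | h a b =>
    rw [SimpleGraph.mem_edgeSet, zdGraph_adj_iff] at hz
    obtain ⟨i, h | h⟩ := hz
    · exact ⟨a, i, by rw [h]⟩
    · exact ⟨b, i, by rw [h, Sym2.eq_swap]⟩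

/-- **Distinct genuine medial vertices have distinct medial points** (`δ ≠ 0`): the midpoint of a
nearest-neighbour edge of `δℤ²` determines the edge (parity of the doubled coordinates).  Hence
under the edge guards of `C′` the stretched-twin / diagonal witnesses of §1 are gone and (ii)
becomes honest asymptotic equicontinuity on the medial lattice. [folklore] -/
theorem medialPoint_injOn_edgeSet {δ : ℝ} (hδ : δ ≠ 0) :
    Set.InjOn (medialPoint δ) (zdGraph 2).edgeSet := by
  intro z hz z' hz' h
  obtain ⟨x, i, rfl⟩ := exists_eq_mk_add_single hz
  obtain ⟨x', i', rfl⟩ := exists_eq_mk_add_single hz'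
  have e0 := sum_eq_of_medialPoint_eq hδ h 0
  have e1 := sum_eq_of_medialPoint_eq hδ h 1
  simp only [Pi.add_apply] at e0 e1
  fin_cases i <;> fin_cases i' <;> simp at e0 e1
  · obtain rfl : x = x' := Site.ext_two (by omega) (by omega); rfl
  · omega
  · omega
  · obtain rfl : x = x' := Site.ext_two (by omega) (by omega); rfl

/-- Under the edge guard the collapse witness of §3 is unavailable: a guarded pair at distance `0`
is the SAME medial vertex, for which (ii) is trivial. [folklore] -/
theorem eq_of_dist_medialPoint_eq_zero {δ : ℝ} (hδ : δ ≠ 0) {z z' : MedialVertex}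
    (hz : z ∈ (zdGraph 2).edgeSet) (hz' : z' ∈ (zdGraph 2).edgeSet)
    (h : dist (medialPoint δ z) (medialPoint δ z') = 0) : z = z' :=
  medialPoint_injOn_edgeSet hδ hz hz' (dist_eq_zero.1 h)

end Summit.CriticalPhenomena.CardyFormulaZ2.Theorems.ParafermionPrecompact.Negative

end
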